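/-
Copyright: literature formalisation for the harness. Statements follow the cited text.
-/
import Literature.AlgebraicGeometry.CossartPiltant200819.TamePrimeDescentAssembly2008
import Literature.AlgebraicGeometry.Resolution.DiscreteSeparableResidueLocalUniformization
import Literature.AlgebraicGeometry.Resolution.MuPTorsorLocalUniformizationRelative
import HarnessLib

/-!
# Cossart–Piltant 2008, Lemma 9.4 (journal 9.2), case `e = l`: the discrete sub-case of the
# rational-rank-one residual is covered by Knaf–Kuhlmann 2009, Thm. 1.5

Bookkeeping only (compositions of tree theorems); no statement of [CossartPiltant2008] is asserted
and no new mathematical claim is made.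

After `TamePrimeDescentAssembly2008.tamePrimeDescent_of_printed_leaves`, Lemma 9.4
(`CP2008.TamePrimeDescent`: for `L/K` Galois of prime degree `l ≠ char k`, `trdeg_k K = 3`, `W` a
rank-one valuation ring of `L` over `k` with `κ(W)/k` algebraic, local uniformizability of `W`
descends to `V = W ∩ K`) is reduced, over an arbitrary ground field `k`, to four printed leaves and
the OPEN residual `CP2008.GStableUniformizationInertialRankOne` — (S3\*) (a `Gal(L/K)`-stable local
uniformization of `W` above `R̃₀`) for inertial `W` of rational rank one.

This file records that a further sub-case of that residual is NOT needed for the lemma: when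
`V = W ∩ K` is a DISCRETE valuation ring (value group `ℤ`) whose residue field is a finite
separable extension of `k` (rendered, as in the `Resolution` topic, by
`Resolution.IsDiscreteWithSeparableResidue k V`: `V` is a discrete valuation ring and `κ(V) = k(ȳ)`
for the residue `ȳ` of some `y ∈ V` that is a root of a separable polynomial over `k`), the
CONCLUSION of Lemma 9.4 — `V` is locally uniformizable over `k` — holds outright, in every
characteristic and every transcendence degree and without any hypothesis on `L`, `W` or `l`, by

* H. Knaf, F.-V. Kuhlmann, *Every place admits local uniformization in a finite extension of the
  function field*, Adv. Math. 221 (2009) 428–453, **Thm. 1.5** (places lying in the completion of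
  an Abhyankar subfunction field with separable residue field extension are strongly smoothly
  uniformizable) — the tree's NAMED FACT `Resolution.KnafKuhlmann2009MonogenicCompletion`
  (hypothesis only, not discharged here) — together with
* F.-V. Kuhlmann, *On local uniformization in arbitrary characteristic I*, arXiv:math/9903097,
  Remark 1 after Thm. 1.12 (a discrete place with residue field `k(ȳ)`, `ȳ` separable, lies in the
  completion of the Abhyankar subfield `k(y')`), PROVED in the tree as
  `Resolution.relLocalUniformization_of_isDiscreteWithSeparableResidue`, and the passage from
  relative to weak local uniformization `Resolution.isLocallyUniformizable_of_relLocalUniformization`.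

Consequently the dependency statement of the directory for the case `e = l` sharpens to
(`tamePrimeDescent_of_printed_leaves_core`):

  Lemma 9.4 ⇐ { Prop 9.3 (`DescentBelowInertiaField`), HAL p. 30 l. 16–65
    (`TamePrimeDescentViaStableModel`), Cor 4.6 (`Cofinality`), the transport
    `PrimaryTransformRankOne` of [Fu1997, Thm 3.6], Knaf–Kuhlmann 2009 Thm. 1.5
    (`KnafKuhlmann2009MonogenicCompletion`), and the CORE residual
    `GStableUniformizationInertialRankOneCore` },

where the core residual is `GStableUniformizationInertialRankOne` restricted to those `W` for which
`V = W ∩ K` is NOT a discrete valuation ring with finite separable residue field extension — i.e.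
(in rational rank one, `κ(V)/k` algebraic) `Γ_V ⊂ ℚ` not finitely generated, or `Γ_V ≅ ℤ` with
`κ(V)/k` inseparable or not finite. `GStableUniformizationInertialRankOne.core` checks that the
core residual is a weakening of the residual. In the inertial case `κ(W) = κ(V)` and
`[Γ_W : Γ_V] = l`, so the dichotomy may equivalently be read on `W`.

Universe. The `Resolution` declarations used (`RelLocalUniformization`,
`IsDiscreteWithSeparableResidue`, `KnafKuhlmann2009MonogenicCompletion`,
`isLocallyUniformizable_of_relLocalUniformization`) are stated over `Type`; accordingly the
statements of this file are the universe-`0` instances `TamePrimeDescent.{0}`, … of the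
(universe-polymorphic) statements of the directory. Nothing else changes.

What is deliberately NOT here: (S3\*) itself (a `G`-stable regular model above `R̃₀`) in the
discrete sub-case, and the discrete sub-case with `κ(V)/k` separable algebraic but not finite
(possible in transcendence degree `≥ 2` over a non-separably-closed `k`), are not claimed; they
stay inside the core residual. The cell's prose record (pub-hironaka GAPS §GA, rider G22-A21.S-D)
discusses both.

## Sources
- [CossartPiltant2008] HAL hal-00139124v1: Lemma 9.4 and its proof (p. 29–30).
- [KnafKuhlmann2009] Adv. Math. 221 (2009) 428–453 = arXiv:math/0702856, Thm. 1.5.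
- [Kuhlmann1999] arXiv:math/9903097, Thm. 1.8 / Cor. 1.9 and Remark 1 after Thm. 1.12.
- [Fu1997] J. Algebra 194 (1997) 614–630, Thm 3.6 (through `PrimaryTransformRankOne`).
-/

namespace Literature.AlgebraicGeometry.CossartPiltant200819.CP2008

open Literature.AlgebraicGeometry.Resolution
open scoped Pointwise IntermediateField

/-! ### The discrete sub-case of the conclusion of Lemma 9.4 is Knaf–Kuhlmann 2009, Thm. 1.5 -/

/-- **The conclusion of Lemma 9.4 in the discrete, separable-residue sub-case, from
Knaf–Kuhlmann 2009 Thm. 1.5** (PROVED bookkeeping): for ANY extension `L/K` of fields over `k`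
with `K/k` finitely generated and any valuation ring `W ⊇ k` of `L`, if `V = W ∩ K` is a discrete
valuation ring whose residue field is `k(ȳ)` with `ȳ` separable algebraic over `k`, then `V` is
locally uniformizable over `k` — no hypothesis on `trdeg`, on `L/K`, on `W` or on `l` is used:
`relLocalUniformization_of_isDiscreteWithSeparableResidue` (Kuhlmann's remark: `K` lies in the
completion of the Abhyankar subfield `k(y')`) and `isLocallyUniformizable_of_relLocalUniformization`.
[cite: KnafKuhlmann2009, Thm. 1.5] -/
theorem descent_of_isDiscreteWithSeparableResidue (hKK : KnafKuhlmann2009MonogenicCompletion)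
    {k K : Type} [Field k] [Field K] [Algebra k K] (hfg : (⊤ : IntermediateField k K).FG)
    {L : Type} [Field L] [Algebra K L] [Algebra k L] [IsScalarTower k K L]
    (W : ValuationSubring L) (hk : ∀ c : k, algebraMap k L c ∈ W)
    (hdisc : IsDiscreteWithSeparableResidue k (W.comap (algebraMap K L))) :
    IsLocallyUniformizable k K (W.comap (algebraMap K L)) :=
  isLocallyUniformizable_of_relLocalUniformization hfg _ (forall_algebraMap_mem_comap (K := K) hk)
    (relLocalUniformization_of_isDiscreteWithSeparableResidue hKK hfg _
      (forall_algebraMap_mem_comap (K := K) hk) hdisc)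

/-! ### The core residual: (S3\*) in rational rank one, off the discrete separable-residue sub-case -/

/-- **(S3\*) in rational rank one, CORE residual**: the statement
`GStableUniformizationInertialRankOne` (HAL p. 30, l. 14–16 for inertial rank-one `W` of the
setting of Lemma 9.4 with `rat.rk W < 2`) restricted to those `W` for which `V = W ∩ K` is NOT a
discrete valuation ring with residue field `k(ȳ)`, `ȳ` separable algebraic over `k` (the
complementary sub-case being irrelevant for Lemma 9.4 by `descent_of_isDiscreteWithSeparableResidue`).
Not established by the printed text nor by [Fu1997]; hypothesis only (pub-hironaka GAPS rows
G7-A21.S, G9-A21.S-R (i), rider G22-A21.S-D). Universe-`0` statement (see the module docstring).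
[cite: CossartPiltant2008, Lemma 9.4 proof (HAL p. 30, l. 11–16)] -/
def GStableUniformizationInertialRankOneCore : Prop :=
  ∀ (k K : Type) [Field k] [Field K] [Algebra k K], (⊤ : IntermediateField k K).FG →
    Algebra.trdeg k K = 3 →
    ∀ (L : Type) [Field L] [Algebra K L] [Algebra k L] [IsScalarTower k K L],
      FiniteDimensional K L → IsGalois K L →
      (Module.finrank K L).Prime → ((Module.finrank K L : ℕ) : K) ≠ 0 →
      ∀ (W : ValuationSubring L) (hk : ∀ c : k, algebraMap k L c ∈ W),
        Nonempty W.valuation.RankOne → residueTrdeg k W hk = 0 → ratRank W < 2 →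
          (∀ σ : L ≃ₐ[K] L, InInertiaGroup K W σ) →
          IsLocallyUniformizable k L W →
          ¬ IsDiscreteWithSeparableResidue k (W.comap (algebraMap K L)) →
          ∀ R₀ : Subalgebra k K, IsNormalLocalModelOf k K (W.comap (algebraMap K L)) R₀ →
            GStableUniformizationAbove (K := K) W R₀

/-- The core residual is a weakening of the rational-rank-one residual (its universe-`0`
instance). [folklore] -/
theorem GStableUniformizationInertialRankOne.core (h : GStableUniformizationInertialRankOne.{0}) :
    GStableUniformizationInertialRankOneCore :=
  fun k K _ _ _ hfg htr L _ _ _ _ hfd hgal hpr hl W hk hrk hres hrr hin hLU _ R₀ hR₀ =>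
    h k K hfg htr L hfd hgal hpr hl W hk hrk hres hrr hin hLU R₀ hR₀

/-! ### Lemma 9.4 from the printed leaves, Knaf–Kuhlmann 2009 Thm. 1.5 and the core residual -/

/-- **Lemma 9.4 (`TamePrimeDescent`, universe `0`) over an arbitrary ground field from printed
leaves, the transport, Knaf–Kuhlmann 2009 Thm. 1.5 and the CORE rank-one residual** (PROVED
bookkeeping): pointwise, if `V = W ∩ K` is a discrete valuation ring with finite separable residue
field extension the conclusion is `descent_of_isDiscreteWithSeparableResidue`; otherwise the
printed argument runs as in `tamePrimeDescent_of_viaStableModel_of_inertia` /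
`gStableUniformizationInertial_of_leaves`: for `G_i(W/V) ≠ G` Prop 9.3
(`descent_of_inertiaGroup_ne_top`), for `G_i(W/V) = G` HAL p. 30 l. 16–65
(`TamePrimeDescentViaStableModel`) fed with (S3\*) — from the transport in rational rank `≥ 2`
(`gStableUniformizationAbove_of_printed_leaves_rankOne`) and from the core residual in rational
rank one. [cite: CossartPiltant2008, Lemma 9.4 (HAL p. 29–30); KnafKuhlmann2009, Thm. 1.5] -/
theorem tamePrimeDescent_of_printed_leaves_core (h93 : DescentBelowInertiaField.{0})
    (h₁ : TamePrimeDescentViaStableModel.{0}) (hcof : Cofinality.{0})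
    (hFu : PrimaryTransformRankOne.{0}) (hKK : KnafKuhlmann2009MonogenicCompletion)
    (h1 : GStableUniformizationInertialRankOneCore) : TamePrimeDescent.{0} := by
  intro k K _ _ _ hfg htr L _ _ _ _ hfd hgal hpr hl W hk hrk hres hLU
  haveI := hfd
  haveI := hgal
  by_cases hdisc : IsDiscreteWithSeparableResidue k (W.comap (algebraMap K L))
  · exact descent_of_isDiscreteWithSeparableResidue hKK hfg W hk hdisc
  by_cases htop : inertiaGroup (K := K) W = ⊤
  · have hin : ∀ σ : L ≃ₐ[K] L, InInertiaGroup K W σ := fun σ =>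
      (mem_inertiaGroup_iff W σ).mp (by rw [htop]; exact Subgroup.mem_top σ)
    have hfix : ∀ σ : L ≃ₐ[K] L, σ • W = W := fun σ =>
      ((mem_inertiaGroup_iff' W σ).mp ((mem_inertiaGroup_iff W σ).mpr (hin σ))).1
    refine h₁ k K hfg htr L hfd hgal hpr hl W hk hrk hres fun R₀ hR₀ => ?_
    rcases le_or_gt (2 : Cardinal) (ratRank W) with hrr | hrr
    · exact gStableUniformizationAbove_of_printed_leaves_rankOne hcof hFu hfg htr W hk hrk hres
        hrr hfix hLU R₀ hR₀
    · exact h1 k K hfg htr L hfd hgal hpr hl W hk hrk hres hrr hin hLU hdisc R₀ hR₀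
  · exact descent_of_inertiaGroup_ne_top h93 hfg htr hpr W hk hrk hres htop hLU

/-- **The same with the residual in its original form** (PROVED bookkeeping): since the core
residual is weaker, `tamePrimeDescent_of_printed_leaves` (universe `0`) also factors through
Knaf–Kuhlmann 2009 Thm. 1.5 — recorded only to make the comparison with
`TamePrimeDescentAssembly2008.tamePrimeDescent_of_printed_leaves` explicit.
[cite: CossartPiltant2008, Lemma 9.4 (HAL p. 29–30)] -/
theorem tamePrimeDescent_of_printed_leaves_of_knafKuhlmann (h93 : DescentBelowInertiaField.{0})
    (h₁ : TamePrimeDescentViaStableModel.{0}) (hcof : Cofinality.{0})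
    (hFu : PrimaryTransformRankOne.{0}) (hKK : KnafKuhlmann2009MonogenicCompletion)
    (h1 : GStableUniformizationInertialRankOne.{0}) : TamePrimeDescent.{0} :=
  tamePrimeDescent_of_printed_leaves_core h93 h₁ hcof hFu hKK h1.core

end Literature.AlgebraicGeometry.CossartPiltant200819.CP2008
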